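import Literature.NumberTheory.Sieve.ParityWave0Proofs
import Literature.NumberTheory.Sieve.MaynardK105
import Literature.NumberTheory.Sieve.MaynardSieve
import HarnessLib

/-!
# Bounded gaps between primes: Maynard's deduction of `liminf (p_{n+1} − p_n) ≤ 600`

Topic `Literature/NumberTheory/Sieve`; a second companion ("Proofs") file of `ParityWave0.lean`,
for its named fact `Literature.NumberTheory.Sieve.frequently_nth_prime_succ_le_add_maynard` (**parity.S13**;
J. Maynard, *Small gaps between primes*, Ann. of Math. (2) 181 (2015), 383–413 = arXiv:1311.4600,
**Theorem 1.3**: `liminf_n (p_{n+1} − p_n) ≤ 600`). It imports `ParityWave0Proofs.lean` for the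
elementary glue of its section `SmallGaps` (`frequently_nth_prime_succ_le_add_of_forall_exists`,
`exists_prime_pair_of_two_le_card`, `bombieriVinogradovStatement_of_bombieri_vinogradov`) and is
kept as a separate file because it introduces two definitions (the explicit `105`-tuple).

Locator. The Wave0 docstring says "Thm 1.2"; in the published numbering (identical in the arXiv
version) Theorem 1.2 is the positive-proportion statement for `m`-tuples and **Theorem 1.3** is
`liminf_n (p_{n+1} − p_n) ≤ 600` (p. 3 of the arXiv version). The vendored STATEMENT is the printed
one (gaps are integers, so `liminf ≤ 600` iff `p_{n+1} ≤ p_n + 600` for infinitely many `n`); only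
the theorem number in the Wave0 docstring is off by one. Nothing is mis-stated.

Maynard's proof of Theorem 1.3 (loc. cit. §4, p. 8: "First we consider Theorem 1.3. We take
`k = 105` …") is a five-line assembly of three deep inputs and one finite computation:

1. the **Bombieri–Vinogradov theorem** — "the primes have level of distribution `θ = 1/2 − ε`
   for any `ε > 0`": the tree's named fact `Literature.NumberTheory.Sieve.BombieriVinogradovStatement`
   (`Literature/NumberTheory/Sieve/LevelOfDistribution.lean`), itself a proved consequence of the
   Wave0 form parity.S27 `Literature.NumberTheory.Sieve.bombieri_vinogradov`
   (`bombieriVinogradovStatement_of_bombieri_vinogradov`, `ParityWave0Proofs.lean`);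
2. **Maynard 2015 Prop. 4.2** (p. 7; with the conclusion in the shape of Thm 3.1): level `θ`, an
   admissible `k`-tuple `H` and a test function `F` with `(∑ₘ J_k^{(m)}(F))/I_k(F) > 2m/θ` give
   infinitely many `n` with at least `m + 1` primes among the `n + hᵢ` — the tree's named fact
   `Literature.NumberTheory.Sieve.frequently_card_primes_ge_of_maynardFunctional` (`…/Sieve/MaynardTao.lean`);
3. **Maynard 2015 Prop. 4.3 (2)** (p. 7): `M₁₀₅ > 4` — the tree's named fact
   `Literature.NumberTheory.Sieve.exists_four_lt_maynardFunctional` (`…/Sieve/MaynardTao.lean`; the text of the proof of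
   Thm 1.3 on p. 8 quotes it as "`M₁₀₅ > 2`", which is all that is used unconditionally);
4. an **admissible `105`-tuple of diameter `600`** (T. Engelsma; printed in full in the footnote
   to the proof of Thm 1.3, p. 8) — DEFINED and PROVED admissible here (`Literature.NumberTheory.Sieve.maynardTuple`,
   `Literature.NumberTheory.Sieve.isAdmissibleTuple_maynardTuple`): by kernel `decide`, every modulus `2 ≤ m ≤ 105` (prime or
   not — composite moduli are harmless and spare us deciding primality in the kernel) misses a
   residue class, and primes `p > 105 = #H` are automatic (`isAdmissibleTuple_iff_of_le_card`).

With `M := (∑ₘ J₁₀₅^{(m)}(F))/I₁₀₅(F) > 4` for the `F` of (3) we take `θ := 1/4 + 1/M ∈ (2/M, 1/2)`,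
so that Bombieri–Vinogradov supplies level `θ` and `2·1/θ < M`; Prop. 4.2 with `m = 1` then gives,
for infinitely many `n`, two primes among the `n + hᵢ` (`0 ≤ hᵢ ≤ 600`), whence
`p_{j+1} ≤ p_j + 600` for the index `j` of the smaller one (`exists_prime_pair_of_two_le_card` and
`frequently_nth_prime_succ_le_add_of_forall_exists` of `ParityWave0Proofs.lean`; this is the
sentence "Therefore, by Proposition 4.2, we have `liminf (p_{n+1} − p_n) ≤ max_{i,j} (hᵢ − hⱼ)`" of
the printed proof). The results are
`Literature.NumberTheory.Sieve.frequently_nth_prime_succ_le_add_maynard_of_bombieriVinogradovStatement` and, composed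
with the bridge from parity.S27, `Literature.NumberTheory.Sieve.frequently_nth_prime_succ_le_add_maynard_of_bombieri_vinogradov`,
both sorry-free and depending on no named fact other than their three displayed hypotheses.

Net effect: `frequently_nth_prime_succ_le_add_maynard` is reduced, sorry-free, to the leaves
(1)–(3), each of which is a theory of its own (large sieve + Vaughan's identity, see
`BombieriVinogradovReduction.lean`; Maynard §§5–6, the multidimensional Selberg sieve asymptotics;
the simplex integrals and the `42 × 42` quadratic-form certificate of Maynard §7). The
unconditional `frequently_nth_prime_succ_le_add_maynard_holds` awaits their discharge and is NOT
claimed here.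

## Second layer (appended): the target from Bombieri–Vinogradov and Prop. 4.1 alone

With Prop. 4.3 (2) discharged (`MaynardK105.lean`: `Literature.NumberTheory.Sieve.exists_four_lt_maynardFunctional_holds`,
via the polynomial certificate `MaynardK105.isMaynardAdmissible_and_four_lt_cert105`) and Prop. 4.2
proved from Prop. 4.1 for `C¹` test functions (`MaynardSieve.lean`:
`Literature.NumberTheory.Sieve.frequently_card_primes_ge_of_maynardFunctional_smooth_of_asymptotics`), the theorems
`frequently_nth_prime_succ_le_add_maynard_of_sieveAsymptotics` and
`frequently_nth_prime_succ_le_add_maynard_of_bombieri_vinogradov_of_sieveAsymptotics` below reduce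
`frequently_nth_prime_succ_le_add_maynard` to the Bombieri–Vinogradov theorem (parity.S27, resp.
`BombieriVinogradovStatement`) and the two halves of Maynard's Prop. 4.1
(`Literature.NumberTheory.Sieve.maynard_S1_asymptotic` = Lemma 6.2, `Literature.NumberTheory.Sieve.maynard_S2_asymptotic` = Lemma 6.3), sorry-free.

## References

* J. Maynard, *Small gaps between primes*, Ann. of Math. (2) 181 (2015), 383–413,
  doi:10.4007/annals.2015.181.1.7, arXiv:1311.4600 [MaynardAnnals2015]: §1, the definition of
  "level of distribution `θ`" (p. 3), Thm 1.3 (p. 3), Props 4.1–4.3 (p. 7), §4 proof of Thm 1.3 with its footnote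
  (the 105-tuple) (p. 8).
* E. Bombieri, *On the large sieve*, Mathematika 12 (1965), 201–225; A. I. Vinogradov, Izv. Akad.
  Nauk SSSR 29 (1965); H. Iwaniec, E. Kowalski, *Analytic Number Theory* (2004), Thm 17.1
  [IwaniecKowalski2004].
-/

open Filter Finset

namespace Literature.NumberTheory.Sieve

/-! ### Engelsma's admissible 105-tuple of diameter 600 -/

/-- The 105 shifts `0 = h₁ < h₂ < ⋯ < h₁₀₅ = 600` of the admissible set used by Maynard (found by
T. Engelsma from A. Sutherland's prime-gaps tables; printed in the footnote to the proof of
Theorem 1.3, Maynard, Ann. of Math. 181 (2015), §4, p. 8 of arXiv:1311.4600), as a list of natural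
numbers, in the printed order. [cite: MaynardAnnals2015, §4, footnote to the proof of Theorem 1.3] -/
def maynardTupleList : List ℕ :=
  [0, 10, 12, 24, 28, 30, 34, 42, 48, 52, 54, 64, 70, 72, 78, 82, 90, 94, 100, 112, 114, 118, 120,
    124, 132, 138, 148, 154, 168, 174, 178, 180, 184, 190, 192, 202, 204, 208, 220, 222, 232, 234,
    250, 252, 258, 262, 264, 268, 280, 288, 294, 300, 310, 322, 324, 328, 330, 334, 342, 352, 358,
    360, 364, 372, 378, 384, 390, 394, 400, 402, 408, 412, 418, 420, 430, 432, 442, 444, 450, 454,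
    462, 468, 472, 478, 484, 490, 492, 498, 504, 510, 528, 532, 534, 538, 544, 558, 562, 570, 574,
    580, 582, 588, 594, 598, 600]

/-- Maynard's admissible `105`-tuple `H = {0, 10, 12, …, 600} ⊆ ℤ` of diameter `600` (Maynard,
Ann. of Math. 181 (2015), §4, footnote to the proof of Theorem 1.3), as a `Finset ℤ` in the format
consumed by `IsAdmissibleTuple` and `frequently_card_primes_ge_of_maynardFunctional`.
[cite: MaynardAnnals2015, §4, footnote to the proof of Theorem 1.3] -/
def maynardTuple : Finset ℤ :=
  (maynardTupleList.map ((↑) : ℕ → ℤ)).toFinset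

/-- The printed shifts are listed in strictly increasing order, `0 = h₁ < h₂ < ⋯ < h₁₀₅`
(a linear-time kernel check). [cite: MaynardAnnals2015, §4, footnote to the proof of Theorem 1.3] -/
theorem sortedLT_maynardTupleList : maynardTupleList.SortedLT := by
  decide +kernel

/-- The printed shifts are pairwise distinct (they are strictly increasing).
[cite: MaynardAnnals2015, §4, footnote to the proof of Theorem 1.3] -/
theorem nodup_maynardTupleList : maynardTupleList.Nodup :=
  sortedLT_maynardTupleList.nodup

/-- Every shift lies in `[0, 600]`, i.e. the tuple has diameter `600` (Maynard 2015 §4: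
"`0 ≤ h₁ < ⋯ < h₁₀₅` and `h₁₀₅ − h₁ = 600`"). [cite: MaynardAnnals2015, §4, proof of Theorem 1.3] -/
theorem forall_mem_maynardTupleList_le : ∀ h ∈ maynardTupleList, h ≤ 600 := by
  decide

/-- The finite admissibility certificate: for every modulus `2 ≤ m ≤ 105` (prime or not) some
residue class `a mod m` contains no shift. For prime `m` this is admissibility at `m`; primes
`p > 105 = #H` are automatic (`isAdmissibleTuple_iff_of_le_card`). Checked by kernel `decide`
(about `5 · 10⁴` residue evaluations; Maynard 2015 §4, proof of Theorem 1.3: "we can choose `H`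
[admissible] such that …", with the footnote listing `H`).
[cite: MaynardAnnals2015, §4, footnote to the proof of Theorem 1.3] -/
theorem exists_residue_notMem_maynardTupleList :
    ∀ m < 106, 2 ≤ m → ∃ a < m, ∀ h ∈ maynardTupleList, h % m ≠ a := by
  decide +kernel

/-- Membership in `maynardTuple`: the elements are the casts of the listed shifts. [folklore] -/
theorem mem_maynardTuple {h : ℤ} : h ∈ maynardTuple ↔ ∃ n ∈ maynardTupleList, (n : ℤ) = h := by
  simp [maynardTuple]

/-- `#H = 105` (Maynard 2015 §4, proof of Theorem 1.3: "We take `k = 105`").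
[cite: MaynardAnnals2015, §4, proof of Theorem 1.3] -/
theorem card_maynardTuple : maynardTuple.card = 105 := by
  rw [maynardTuple, List.toFinset_card_of_nodup (nodup_maynardTupleList.map Nat.cast_injective),
    List.length_map]
  rfl

/-- The shifts satisfy `0 ≤ h ≤ 600` (diameter `600`; Maynard 2015 §4, proof of Theorem 1.3).
[cite: MaynardAnnals2015, §4, proof of Theorem 1.3] -/
theorem mem_maynardTuple_bounds : ∀ h ∈ maynardTuple, (0 : ℤ) ≤ h ∧ h ≤ (600 : ℕ) := by
  intro h hh
  obtain ⟨n, hn, rfl⟩ := mem_maynardTuple.mp hh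
  exact ⟨by positivity, by exact_mod_cast forall_mem_maynardTupleList_le n hn⟩

/-- **Maynard's 105-tuple is admissible** (Maynard, Ann. of Math. 181 (2015), §4, proof of
Theorem 1.3 and its footnote): for every prime `p` the shifts miss a residue class mod `p`.
Proof: for `p ≤ 105` by the finite certificate `exists_residue_notMem_maynardTupleList` (the
image of `H` in `ZMod p` avoids the class of the certified residue `a`, so `ν_H(p) ≤ p − 1`), for
`p > 105 = #H` by counting (`isAdmissibleTuple_iff_of_le_card`).
[cite: MaynardAnnals2015, §4, footnote to the proof of Theorem 1.3] -/
theorem isAdmissibleTuple_maynardTuple : IsAdmissibleTuple maynardTuple := by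
  rw [isAdmissibleTuple_iff_of_le_card, card_maynardTuple]
  intro p hp hple
  obtain ⟨a, ha, hmiss⟩ := exists_residue_notMem_maynardTupleList p (by omega) hp.two_le
  haveI : NeZero p := ⟨hp.ne_zero⟩
  have hsub : maynardTuple.image (fun h : ℤ ↦ (h : ZMod p)) ⊆ Finset.univ.erase (a : ZMod p) := by
    intro x hx
    obtain ⟨h, hh, rfl⟩ := Finset.mem_image.mp hx
    obtain ⟨n, hn, rfl⟩ := mem_maynardTuple.mp hh
    refine Finset.mem_erase.mpr ⟨fun heq ↦ ?_, Finset.mem_univ _⟩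
    rw [Int.cast_natCast, ZMod.natCast_eq_natCast_iff', Nat.mod_eq_of_lt ha] at heq
    exact hmiss n hn heq
  calc tupleResidueCount maynardTuple p
      ≤ (Finset.univ.erase (a : ZMod p)).card := Finset.card_le_card hsub
    _ = p - 1 := by rw [Finset.card_erase_of_mem (Finset.mem_univ _), Finset.card_univ, ZMod.card]
    _ < p := Nat.sub_lt hp.pos one_pos

end Literature.NumberTheory.Sieve

namespace Literature.NumberTheory.Sieve

open Filter

/-! ### Maynard 2015, Theorem 1.3, from its three deep inputs -/

/-- **Maynard 2015, Theorem 1.3, exactly as deduced in §4 of the paper** (Maynard, Ann. of Math.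
181 (2015), Thm 1.3, p. 3, and §4, p. 8: "First we consider Theorem 1.3. We take `k = 105`. By
Proposition 4.3, we have `M₁₀₅ > 2` [indeed `> 4`]. By the Bombieri–Vinogradov theorem, the
primes have level of distribution `θ = 1/2 − ε` for any `ε > 0`. Thus, if we take `ε` sufficiently
small, we have `θ M₁₀₅/2 > 1`. Therefore, by Proposition 4.2, we have
`liminf (p_{n+1} − p_n) ≤ max_{1 ≤ i,j ≤ 105} (hᵢ − hⱼ)` for any admissible set
`H = {h₁, …, h₁₀₅}` … we can choose `H` such that `0 ≤ h₁ < ⋯ < h₁₀₅` and `h₁₀₅ − h₁ = 600`.").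
Inputs, as hypotheses: the Bombieri–Vinogradov theorem in level form
(`BombieriVinogradovStatement`: level `θ` for every `θ < 1/2`), Maynard's Prop. 4.2
(`frequently_card_primes_ge_of_maynardFunctional`) and Prop. 4.3 (2)
(`exists_four_lt_maynardFunctional`: an admissible `F` on `R₁₀₅` with
`M := (∑ₘ J^{(m)}(F))/I(F) > 4`); output: `frequently_nth_prime_succ_le_add_maynard`
(`liminf (p_{n+1} − p_n) ≤ 600`). Proof as printed with the explicit choice `θ := 1/4 + 1/M`
(`0 < θ < 1/2` and `2/θ < M`), `k = 105`, `m = 1`, the admissible 105-tuple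
`maynardTuple ⊆ [0, 600]` (`isAdmissibleTuple_maynardTuple`, `card_maynardTuple`,
`mem_maynardTuple_bounds`), and the glue `exists_prime_pair_of_two_le_card`,
`frequently_nth_prime_succ_le_add_of_forall_exists`.
[cite: MaynardAnnals2015, Theorem 1.3 and its proof in §4] -/
theorem frequently_nth_prime_succ_le_add_maynard_of_bombieriVinogradovStatement
    (hBV : BombieriVinogradovStatement)
    (h42 : frequently_card_primes_ge_of_maynardFunctional)
    (h43 : exists_four_lt_maynardFunctional) :
    frequently_nth_prime_succ_le_add_maynard := by
  obtain ⟨F, hF, hM4⟩ := h43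
  set M := maynardFunctional 105 F with hM
  have hMpos : 0 < M := by linarith
  have hθ0 : (0 : ℝ) < 1 / 4 + 1 / M := by positivity
  have hθhalf : 1 / 4 + 1 / M < (1 / 2 : ℝ) := by
    have : 1 / M < 1 / 4 := one_div_lt_one_div_of_lt (by norm_num) hM4
    linarith
  have hMθ : 2 * ((1 : ℕ) : ℝ) / (1 / 4 + 1 / M) < maynardFunctional 105 F := by
    rw [Nat.cast_one, mul_one, div_lt_iff₀ hθ0, ← hM]
    have hprod : M * (1 / 4 + 1 / M) = M / 4 + 1 := by
      field_simp
    rw [hprod]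
    linarith
  have hfreq := h42 (1 / 4 + 1 / M) hθ0 (hBV _ hθhalf) 1 105 F hF hMθ maynardTuple
    isAdmissibleTuple_maynardTuple card_maynardTuple
  refine frequently_nth_prime_succ_le_add_of_forall_exists fun N => ?_
  obtain ⟨n, hnN, hn⟩ := ((eventually_ge_atTop N).and_frequently hfreq).exists
  obtain ⟨p, p', hnp, hp, hp', hlt, hle⟩ :=
    exists_prime_pair_of_two_le_card mem_maynardTuple_bounds (le_trans (by norm_num) hn)
  exact ⟨p, p', hnN.trans hnp, hp, hp', hlt, hle⟩

/-- **Maynard 2015, Theorem 1.3, reduced to parity.S27 and Maynard's Propositions 4.2 / 4.3 (2).**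
The accepted Wave0 Bombieri–Vinogradov fact `bombieri_vinogradov` (parity.S27; Bombieri,
Mathematika 12 (1965), Thm 4), Maynard's Prop. 4.2 with the conclusion of Thm 3.1
(`frequently_card_primes_ge_of_maynardFunctional`) and Prop. 4.3 (2)
(`exists_four_lt_maynardFunctional`, `M₁₀₅ > 4`) imply `liminf (p_{n+1} − p_n) ≤ 600`
(`frequently_nth_prime_succ_le_add_maynard`): the previous theorem composed with
`bombieriVinogradovStatement_of_bombieri_vinogradov`. This is the DAG along which
`frequently_nth_prime_succ_le_add_maynard_holds` is to be discharged.
[cite: MaynardAnnals2015, Theorem 1.3 and its proof in §4] -/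
theorem frequently_nth_prime_succ_le_add_maynard_of_bombieri_vinogradov
    (hBV : bombieri_vinogradov)
    (h42 : frequently_card_primes_ge_of_maynardFunctional)
    (h43 : exists_four_lt_maynardFunctional) :
    frequently_nth_prime_succ_le_add_maynard :=
  frequently_nth_prime_succ_le_add_maynard_of_bombieriVinogradovStatement
    (bombieriVinogradovStatement_of_bombieri_vinogradov hBV) h42 h43

end Literature.NumberTheory.Sieve


namespace Literature.NumberTheory.Sieve

open Filter MaynardK105

/-- **Maynard 2015, Theorem 1.3, reduced to Bombieri–Vinogradov and the sieve asymptotics of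
Prop. 4.1 (Lemmas 6.2, 6.3).** With Prop. 4.3 (2) now PROVED (`MaynardK105.lean`:
`isMaynardAdmissible_and_four_lt_cert105`, a polynomial `P` on `R₁₀₅` with
`(∑ₘ J^{(m)})/I > 4`) and Prop. 4.2 PROVED from Prop. 4.1 for `C¹` test functions
(`MaynardSieve.lean`: `frequently_card_primes_ge_of_maynardFunctional_smooth_of_asymptotics`), the
target `liminf (p_{n+1} − p_n) ≤ 600` follows from the Bombieri–Vinogradov theorem
(`BombieriVinogradovStatement`) and the two halves of Maynard's Prop. 4.1
(`maynard_S1_asymptotic` = Lemma 6.2, `maynard_S2_asymptotic` = Lemma 6.3), exactly along the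
printed proof (§4, p. 8): `k = 105`, `θ = 1/4 + 1/M < 1/2` with `M = (∑ₘ J^{(m)}(F))/I(F) > 4`,
`m = 1`, the admissible `maynardTuple ⊆ [0, 600]`, and the glue of `ParityWave0Proofs.lean`.
[cite: MaynardAnnals2015, Theorem 1.3 and its proof in §4] -/
theorem frequently_nth_prime_succ_le_add_maynard_of_sieveAsymptotics
    (hBV : BombieriVinogradovStatement)
    (hS1 : maynard_S1_asymptotic) (hS2 : maynard_S2_asymptotic) :
    frequently_nth_prime_succ_le_add_maynard := by
  have h42 := frequently_card_primes_ge_of_maynardFunctional_smooth_of_asymptotics hS1 hS2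
  obtain ⟨hF, hM4⟩ := isMaynardAdmissible_and_four_lt_cert105
  have hG : ContDiff ℝ 1 (maynardPoly (104 + 1) (fun i => (certA i : ℝ)) certB certC) :=
    contDiff_maynardPoly _ _ _ _
  have hFG : maynardF (104 + 1) (fun i => (certA i : ℝ)) certB certC =
      (maynardSimplex (104 + 1)).indicator
        (maynardPoly (104 + 1) (fun i => (certA i : ℝ)) certB certC) := rfl
  rw [hFG] at hF hM4
  set M := maynardFunctional (104 + 1) ((maynardSimplex (104 + 1)).indicator
    (maynardPoly (104 + 1) (fun i => (certA i : ℝ)) certB certC)) with hM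
  have hM4' : (4 : ℝ) < M := by exact_mod_cast hM4
  have hMpos : 0 < M := by linarith
  have hθ0 : (0 : ℝ) < 1 / 4 + 1 / M := by positivity
  have hθhalf : 1 / 4 + 1 / M < (1 / 2 : ℝ) := by
    have : 1 / M < 1 / 4 := one_div_lt_one_div_of_lt (by norm_num) hM4'
    linarith
  have hMθ : 2 * ((1 : ℕ) : ℝ) / (1 / 4 + 1 / M) < M := by
    rw [Nat.cast_one, mul_one, div_lt_iff₀ hθ0]
    have hprod : M * (1 / 4 + 1 / M) = M / 4 + 1 := by
      field_simp
    rw [hprod]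
    linarith
  have hfreq := h42 (1 / 4 + 1 / M) hθ0 (hBV _ hθhalf) 1 (104 + 1) _ hG hF hMθ maynardTuple
    isAdmissibleTuple_maynardTuple card_maynardTuple
  refine frequently_nth_prime_succ_le_add_of_forall_exists fun N => ?_
  obtain ⟨n, hnN, hn⟩ := ((eventually_ge_atTop N).and_frequently hfreq).exists
  obtain ⟨p, p', hnp, hp, hp', hlt, hle⟩ :=
    exists_prime_pair_of_two_le_card mem_maynardTuple_bounds (le_trans (by norm_num) hn)
  exact ⟨p, p', hnN.trans hnp, hp, hp', hlt, hle⟩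

/-- **Maynard 2015, Theorem 1.3, from parity.S27 and Prop. 4.1.** The previous theorem composed
with the bridge `bombieriVinogradovStatement_of_bombieri_vinogradov` from the accepted Wave0
Bombieri–Vinogradov fact (parity.S27): `liminf (p_{n+1} − p_n) ≤ 600` follows from
`bombieri_vinogradov`, `maynard_S1_asymptotic` and `maynard_S2_asymptotic` alone. This is the DAG
along which `frequently_nth_prime_succ_le_add_maynard_holds` is to be completed.
[cite: MaynardAnnals2015, Theorem 1.3 and its proof in §4] -/
theorem frequently_nth_prime_succ_le_add_maynard_of_bombieri_vinogradov_of_sieveAsymptotics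
    (hBV : bombieri_vinogradov)
    (hS1 : maynard_S1_asymptotic) (hS2 : maynard_S2_asymptotic) :
    frequently_nth_prime_succ_le_add_maynard :=
  frequently_nth_prime_succ_le_add_maynard_of_sieveAsymptotics
    (bombieriVinogradovStatement_of_bombieri_vinogradov hBV) hS1 hS2

end Literature.NumberTheory.Sieve
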